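import Summits.CriticalPhenomena.SAWScalingLimit.Theses.SAWPhaseRetrieval
import Summits.CriticalPhenomena.SAWScalingLimit.Theorems.SAWDefectDecoherenceObservableToSLERNestedLinkDefs
import Summits.CriticalPhenomena.SAWScalingLimit.Theorems.SAWDefectDecoherenceObservableToSLERResidueAssemblySolid
import Literature.Probability.RandomPlanarGeometry.HullSubdomainPullback
import Literature.Probability.RandomPlanarGeometry.RestrictionHulls
import HarnessLib

/-! Strategist sketch (crux stmt-CriticalPhenomena-14005 `ObservableToSLER`, route SAWPhaseRetrieval):
the four sub-cruxes of the proposed glued split, typed in the ROUTE FILE's context (same namespace and `open`s as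
`Theses/SAWPhaseRetrieval.lean`, vocabulary reached by term-level `open … in`), and the certificate that the LANDED residue
assembly `Residue.observableToSLER_of_residueSolid` (p137704) is the glue `Sub₁ → Sub₂ → Sub₃ → Sub₄ → ObservableToSLER` by
definitional unfolding. -/

namespace Summit.CriticalPhenomena.SAWScalingLimit.Theses.SAWPhaseRetrieval

open scoped BigOperators Topology Manifold Classical MeasureTheory ProbabilityTheory Matrix InnerProductSpace ComplexConjugate ContinuousMap
open Filter Set Function TopologicalSpace MeasureTheory

/-- Sub₁ (S1 / 2ʀ of skeleton r11, registered stub `stub_nestedRenewalFatCoSolidR` verbatim): NESTED RENEWAL ABUNDANCE with fat co-oriented solid tame families, locality scale bounded. -/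
def RenewalAbundance : Prop :=
  open Literature.Probability.LatticeModels (HexVertex hexGraph hexCenter triZeta triEmbed Site polyline) in open Literature.Probability.RandomPlanarGeometry Literature.Probability.RandomPlanarGeometry.SAW Summit.CriticalPhenomena.SAWScalingLimit.Theorems.ObservableToSLER.BridgeGate Summit.CriticalPhenomena.SAWScalingLimit.Theorems.ObservableToSLER.NestedGate Metric in open UpperHalfPlane (upperHalfPlaneSet) in ∀ (D : DobrushinDomain) (a b : ℝ → HexVertex), IsEmbEndpointApprox hexGraph hexCenter D a b → ∀ ε > (0 : ℝ), ∃ R₂ > (0 : ℝ), ∀ R ∈ Set.Ioc (0 : ℝ) R₂, ∃ ρ > (0 : ℝ), ∃ N : ℕ, ∀ᶠ δ : ℝ in 𝓝[>] 0, ∃ S T : ℕ → Set HexVertex, TameNestedFamily δ R N (a δ) S ∧ TameNestedFamily δ R N (b δ) T ∧ ((∀ n, ExteriorAnchored D.carrier δ (S n) (a δ)) ∧ (∀ n, ExteriorAnchored D.carrier δ (T n) (b δ)) ∧ ∃ j : Fin 6, ((∀ (n : ℕ) (p q : HexVertex), HasCleanWindow D.carrier δ ρ (S n) p q → rowOf j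 q = rowOf j p + 1 ∧ ∀ x : HexVertex, (δ : ℂ) * hexCenter x ∈ ball ((δ : ℂ) * hexCenter q) ρ → (x ∈ S n ↔ rowOf j x ≤ rowOf j p)) ∧ (∀ (n : ℕ) (p q : HexVertex), HasCleanWindow D.carrier δ ρ (T n) p q → rowOf j q = rowOf j p + 1 ∧ ∀ x : HexVertex, (δ : ℂ) * hexCenter x ∈ ball ((δ : ℂ) * hexCenter q) ρ → (x ∈ T n ↔ rowOf j x ≤ rowOf j p))) ∧ (∀ (n : ℕ) (p q : HexVertex), HasCleanWindow D.carrier δ ρ (S n) p q → ∃ K : Set ℂ, IsCompact K ∧ IsConnected K ∧ (δ : ℂ) * hexCenter q - ((ρ / 2 : ℝ) : ℂ) * Complex.I * triZeta ^ (j : ℕ) ∈ K ∧ (δ : ℂ) * hexCenter (a δ) ∈ K ∧ ∀ v : HexVertex, Metric.infDist ((δ : ℂ) * hexCenter v) K ≤ ρ / 4 → v ∈ S n) ∧ (∀ (n : ℕ) (p q : HexVertex), HasCleanWindow D.carrier δ ρ (T n) p q → ∃ K : Set ℂ, IsCompact K ∧ IsConnected K ∧ (δ : ℂ) * hexCenter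 q - ((ρ / 2 : ℝ) : ℂ) * Complex.I * triZeta ^ (j : ℕ) ∈ K ∧ (δ : ℂ) * hexCenter (b δ) ∈ K ∧ ∀ v : HexVertex, Metric.infDist ((δ : ℂ) * hexCenter v) K ≤ ρ / 4 → v ∈ T n) ∧ (∀ n : ℕ, ∃ K : Set ℂ, IsCompact K ∧ IsConnected K ∧ (δ : ℂ) * hexCenter (a δ) ∈ K ∧ (∀ v : HexVertex, Metric.infDist ((δ : ℂ) * hexCenter v) K ≤ ρ / 8 → v ∈ S n) ∧ (∀ v ∈ S n, ∃ (t w : HexVertex) (r : ℕ), v ∈ hexBall t r ∧ w ∈ hexBall t r ∧ hexBall t r ⊆ S n ∧ Metric.infDist ((δ : ℂ) * hexCenter w) K ≤ ρ / 16)) ∧ (∀ n : ℕ, ∃ K : Set ℂ, IsCompact K ∧ IsConnected K ∧ (δ : ℂ) * hexCenter (b δ) ∈ K ∧ (∀ v : HexVertex, Metric.infDist ((δ : ℂ) * hexCenter v) K ≤ ρ / 8 → v ∈ T n) ∧ (∀ v ∈ T n, ∃ (t w : HexVertex) (r : ℕ), v ∈ hexBall t r ∧ w ∈ hexBall t r ∧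 hexBall t r ⊆ T n ∧ Metric.infDist ((δ : ℂ) * hexCenter w) K ≤ ρ / 16))) ∧ hexSAWLaw D.carrier δ (a δ) (b δ) {γ | ¬ ∃ (n m : ℕ) (p q : HexVertex) (n' m' : ℕ) (p' q' : HexVertex), IsFirstGoodGateN D.carrier δ ρ R S (a δ) γ.walk.support n m p q ∧ IsFirstGoodGateN D.carrier δ ρ R T (b δ) γ.walk.support.reverse n' m' p' q' ∧ WideLink D.carrier δ ρ (S n ∪ T n') q q'} ≤ ENNReal.ofReal ε

/-- Sub₂ (T1 / 5a1, registered stub `stub_twoPieceSourceLocality` verbatim): TWO-PIECE SOURCE LOCALITY (the anchor). -/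
def SourceLocality : Prop :=
  open Literature.Probability.LatticeModels (HexVertex hexGraph hexCenter triZeta triEmbed Site polyline) in open Literature.Probability.RandomPlanarGeometry Literature.Probability.RandomPlanarGeometry.SAW Summit.CriticalPhenomena.SAWScalingLimit.Theorems.ObservableToSLER.BridgeGate Summit.CriticalPhenomena.SAWScalingLimit.Theorems.ObservableToSLER.NestedGate Metric in open UpperHalfPlane (upperHalfPlaneSet) in ∀ (E : DobrushinDomain) (ρ : ℝ) (Λ : ℝ → Finset HexVertex) (m₀ : ℝ → ℤ) (a : ℝ → Sym2 HexVertex), 0 < ρ → E.carrier ∩ ball (E.pt 0) ρ = {z : ℂ | (E.pt 0).im < z.im} ∩ ball (E.pt 0) ρ → (∀ᶠ δ : ℝ in 𝓝[>] 0, hexDomainSimplyConnected (Λ δ) ∧ a δ ∈ hexDomainBoundary (Λ δ) ∧ (∀ v ∈ Λ δ, (δ : ℂ) * hexCenter v ∈ E.carrier) ∧ (∀ v : HexVertex, (δ : ℂ) * hexCenter v ∈ ball (E.pt 0) ρ → (v ∈ Λ δ ↔ m₀ δ ≤ v.1 1))) → Tendsto (fun δ : ℝ => (δ : ℂ) * hexMidpoint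 (a δ)) (𝓝[>] 0) (𝓝 (E.pt 0)) → ∀ ε : ℝ, 0 < ε → ∃ K : ℝ, 0 < K ∧ ∃ t₀ : ℝ, 0 < t₀ ∧ ∀ (s : ℝ → Sym2 HexVertex) (t : ℝ), t ≠ 0 → |t| < t₀ → (∀ᶠ δ : ℝ in 𝓝[>] 0, s δ ∈ hexDomainBoundary (Λ δ) ∧ (hexMidpoint (s δ)).im = (hexMidpoint (a δ)).im) → Tendsto (fun δ : ℝ => (δ : ℂ) * hexMidpoint (s δ)) (𝓝[>] 0) (𝓝 (E.pt 0 + t)) → ∀ᶠ δ : ℝ in 𝓝[>] 0, (∑ γ : HexMidEdgeSAW (Λ δ) (a δ) (s δ), if ∃ v ∈ γ.verts, K * |t| ≤ dist ((δ : ℂ) * hexCenter v) ((δ : ℂ) * hexMidpoint (a δ)) then hexCriticalFugacity ^ γ.length else 0) ≤ ε * ∑ γ : HexMidEdgeSAW (Λ δ) (a δ) (s δ), hexCriticalFugacity ^ γ.length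

/-- Sub₃ (T5ₐ / 5mₐ = EXISTING item stmt-CriticalPhenomena-7148 `SAWLatticeVirasoro.HexSimpleSubseqLimits`, statement verbatim): simplicity and boundary avoidance of all subsequential limits. -/
def HexSimpleSubseqLimits : Prop :=
  ∀ (D : Literature.Probability.RandomPlanarGeometry.DobrushinDomain) (a b : ℝ → Literature.Probability.LatticeModels.HexVertex), Literature.Probability.RandomPlanarGeometry.SAW.IsEmbEndpointApprox Literature.Probability.LatticeModels.hexGraph Literature.Probability.LatticeModels.hexCenter D a b → ∀ (s : ℕ → ℝ) (ν : MeasureTheory.Measure (Literature.Probability.RandomPlanarGeometry.CurveClass ℂ)), Filter.Tendsto s Filter.atTop (nhdsWithin 0 (Set.Ioi 0)) → MeasureTheory.IsProbabilityMeasure ν → (∀ f : BoundedContinuousFunction (Literature.Probability.RandomPlanarGeometry.CurveClass ℂ) ℝ, Filter.Tendsto (fun n => ∫ γ, f γ.curve ∂(Literature.Probability.RandomPlanarGeometry.SAW.hexSAWLaw D.carrier (s n) (a (s n)) (b (s n)))) Filter.atTop (nhds (∫ x, f x ∂ν))) → ∀ᵐ γ ∂ν, γ ∈ Literature.Probability.RandomPlanarGeometry.CurveClass.simple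 ∧ γ.source = D.pt 0 ∧ γ.target = D.pt 1 ∧ γ.range ⊆ closure D.carrier ∧ γ.range ∩ frontier D.carrier ⊆ {D.pt 0, D.pt 1}

/-- Sub₄ (T2b″ / 5a4″, registered stub `stub_carvedReduction_squeezeSolid` verbatim; provable soft geometry, in flight): the solid moving-carving squeeze from the two-piece admissible restriction limit. -/
def CarvedSqueeze : Prop :=
  open Literature.Probability.LatticeModels (HexVertex hexGraph hexCenter triZeta triEmbed Site polyline) in open Literature.Probability.RandomPlanarGeometry Literature.Probability.RandomPlanarGeometry.SAW Summit.CriticalPhenomena.SAWScalingLimit.Theorems.ObservableToSLER.BridgeGate Summit.CriticalPhenomena.SAWScalingLimit.Theorems.ObservableToSLER.NestedGate Metric in open UpperHalfPlane (upperHalfPlaneSet) in (∀ (D D' : DobrushinDomain) (ρ : ℝ) (φ : ConformalEquiv upperHalfPlaneSet D.carrier) (Φ : ConformalEquiv (upperHalfPlaneSet \ φ.pullbackHull D') upperHalfPlaneSet) (d : ℝ) (Λ Λ' : ℝ → Finset HexVertex) (m₀ m₁ m₁' : ℝ → ℤ) (a b : ℝ → Sym2 HexVertex), (0 < ρ ∧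 ∀ i : Fin 2, D.carrier ∩ ball (D.pt i) ρ = {z : ℂ | (D.pt i).im < z.im} ∩ ball (D.pt i) ρ) → D.IsHullSubdomain D' → D.IsChordalUniformizing φ → IsRestrictionMap (φ.pullbackHull D') Φ → HasRestrictionDeriv (φ.pullbackHull D') Φ d → (∀ᶠ δ : ℝ in 𝓝[>] 0, Λ' δ ⊆ Λ δ ∧ hexDomainSimplyConnected (Λ δ) ∧ hexDomainSimplyConnected (Λ' δ) ∧ (hexGraph.induce (↑(Λ δ) : Set HexVertex)).Preconnected ∧ (hexGraph.induce (↑(Λ' δ) : Set HexVertex)).Preconnected ∧ a δ ∈ hexDomainBoundary (Λ δ) ∧ b δ ∈ hexDomainBoundary (Λ δ) ∧ a δ ∈ hexDomainBoundary (Λ' δ) ∧ b δ ∈ hexDomainBoundary (Λ' δ) ∧ Nonempty (HexMidEdgeSAW (Λ' δ) (a δ) (b δ)) ∧ (∀ v ∈ Λ δ, (δ : ℂ) * hexCenter v ∈ D.carrier) ∧ (∀ v ∈ Λ' δ, (δ : ℂ) * hexCenter v ∈ D'.carrier) ∧ (∀ v : HexVertex, (δ : ℂ) * hexCenter v ∈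 ball (D.pt 0) ρ → ((v ∈ Λ δ ↔ m₀ δ ≤ v.1 1) ∧ (v ∈ Λ' δ ↔ m₀ δ ≤ v.1 1))) ∧ (∀ v : HexVertex, (δ : ℂ) * hexCenter v ∈ ball (D.pt 1) ρ → ((v ∈ Λ δ ↔ m₁ δ ≤ v.1 1) ∧ (v ∈ Λ' δ ↔ m₁' δ ≤ v.1 1)))) → (∀ K : Set ℂ, IsCompact K → K ⊆ D.carrier → ∀ᶠ δ : ℝ in 𝓝[>] 0, ∀ v : HexVertex, (δ : ℂ) * hexCenter v ∈ K → v ∈ Λ δ) → (∀ K : Set ℂ, IsCompact K → K ⊆ D'.carrier → ∀ᶠ δ : ℝ in 𝓝[>] 0, ∀ v : HexVertex, (δ : ℂ) * hexCenter v ∈ K → v ∈ Λ' δ) → Tendsto (fun δ : ℝ => (δ : ℂ) * hexMidpoint (a δ)) (𝓝[>] 0) (𝓝 (D.pt 0)) → Tendsto (fun δ : ℝ => (δ : ℂ) * hexMidpoint (b δ)) (𝓝[>] 0) (𝓝 (D.pt 1)) → Tendsto (fun δ : ℝ => (∑ γ : HexMidEdgeSAW (Λ' δ) (a δ) (b δ),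 hexCriticalFugacity ^ γ.length) / (∑ γ : HexMidEdgeSAW (Λ δ) (a δ) (b δ), hexCriticalFugacity ^ γ.length)) (𝓝[>] 0) (𝓝 (d ^ ((5 : ℝ) / 8)))) → (∀ (D : DobrushinDomain) (a b : ℝ → HexVertex), IsEmbEndpointApprox hexGraph hexCenter D a b → ∀ η > (0 : ℝ), ∃ R₀ > (0 : ℝ), ∀ R ∈ Set.Ioc (0 : ℝ) R₀, ∀ ρ > (0 : ℝ), ∀ N : ℕ, ∀ (δ : ℕ → ℝ) (S T : ℕ → ℕ → Set HexVertex) (n n' : ℕ → ℕ) (q q' : ℕ → HexVertex), Tendsto δ atTop (𝓝[>] 0) → (∀ k, TameNestedFamily (δ k) R N (a (δ k)) (S k) ∧ TameNestedFamily (δ k) R N (b (δ k)) (T k) ∧ (((∀ i, ExteriorAnchored D.carrier (δ k) (S k i) (a (δ k))) ∧ (∀ i, ExteriorAnchored D.carrier (δ k) (T k i) (b (δ k))) ∧ (∀ (i : ℕ) (p q : HexVertex), HasCleanWindow D.carrier (δ k) ρ (S k i) p q → rowOf 0 q = rowOf 0 p + 1 ∧ ∀ x : HexVertex, ((δ k :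 ℝ) : ℂ) * hexCenter x ∈ ball (((δ k : ℝ) : ℂ) * hexCenter q) ρ → (x ∈ S k i ↔ rowOf 0 x ≤ rowOf 0 p)) ∧ (∀ (i : ℕ) (p q : HexVertex), HasCleanWindow D.carrier (δ k) ρ (T k i) p q → rowOf 0 q = rowOf 0 p + 1 ∧ ∀ x : HexVertex, ((δ k : ℝ) : ℂ) * hexCenter x ∈ ball (((δ k : ℝ) : ℂ) * hexCenter q) ρ → (x ∈ T k i ↔ rowOf 0 x ≤ rowOf 0 p))) ∧ (∀ (i : ℕ) (p q : HexVertex), HasCleanWindow D.carrier (δ k) ρ (S k i) p q → ∃ K : Set ℂ, IsCompact K ∧ IsConnected K ∧ ((δ k : ℝ) : ℂ) * hexCenter q - ((ρ / 2 : ℝ) : ℂ) * Complex.I ∈ K ∧ ((δ k : ℝ) : ℂ) * hexCenter (a (δ k)) ∈ K ∧ ∀ v : HexVertex, Metric.infDist (((δ k : ℝ) : ℂ) * hexCenter v) K ≤ ρ / 4 → v ∈ S k i) ∧ (∀ (i : ℕ) (p q : HexVertex), HasCleanWindow D.carrier (δ k) ρ (T k i) p q → ∃ K : Set ℂ, IsCompact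 K ∧ IsConnected K ∧ ((δ k : ℝ) : ℂ) * hexCenter q - ((ρ / 2 : ℝ) : ℂ) * Complex.I ∈ K ∧ ((δ k : ℝ) : ℂ) * hexCenter (b (δ k)) ∈ K ∧ ∀ v : HexVertex, Metric.infDist (((δ k : ℝ) : ℂ) * hexCenter v) K ≤ ρ / 4 → v ∈ T k i) ∧ (∀ i : ℕ, ∃ K : Set ℂ, IsCompact K ∧ IsConnected K ∧ ((δ k : ℝ) : ℂ) * hexCenter (a (δ k)) ∈ K ∧ (∀ v : HexVertex, Metric.infDist (((δ k : ℝ) : ℂ) * hexCenter v) K ≤ ρ / 8 → v ∈ S k i) ∧ (∀ v ∈ S k i, ∃ (t w : HexVertex) (r : ℕ), v ∈ hexBall t r ∧ w ∈ hexBall t r ∧ hexBall t r ⊆ S k i ∧ Metric.infDist (((δ k : ℝ) : ℂ) * hexCenter w) K ≤ ρ / 16)) ∧ (∀ i : ℕ, ∃ K : Set ℂ, IsCompact K ∧ IsConnected K ∧ ((δ k : ℝ) : ℂ) * hexCenter (b (δ k)) ∈ K ∧ (∀ v : HexVertex, Metric.infDist (((δ k : ℝ) : ℂ) * hexCenter v)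 K ≤ ρ / 8 → v ∈ T k i) ∧ (∀ v ∈ T k i, ∃ (t w : HexVertex) (r : ℕ), v ∈ hexBall t r ∧ w ∈ hexBall t r ∧ hexBall t r ⊆ T k i ∧ Metric.infDist (((δ k : ℝ) : ℂ) * hexCenter w) K ≤ ρ / 16)))) → (∀ k, ∃ (γ : HexDomainSAW D.carrier (δ k) (a (δ k)) (b (δ k))) (m : ℕ) (p : HexVertex) (m' : ℕ) (p' : HexVertex), IsFirstGoodGateN D.carrier (δ k) ρ R (S k) (a (δ k)) γ.walk.support (n k) m p (q k) ∧ IsFirstGoodGateN D.carrier (δ k) ρ R (T k) (b (δ k)) γ.walk.support.reverse (n' k) m' p' (q' k) ∧ WideLink D.carrier (δ k) ρ (S k (n k) ∪ T k (n' k)) (q k) (q' k)) → ∀ ε' > (0 : ℝ), ∀ φ : ℕ → ℕ, StrictMono φ → ∃ (ψ : ℕ → ℕ) (M : DobrushinDomain) (τ : ℂ) (ρ' : ℝ) (Λ' : ℝ → Finset HexVertex) (m : Fin 2 → ℝ → ℤ) (a' b' : ℝ → Sym2 HexVertex) (x : ℕ → Site 2) (Λ'' : ℕ → Finset HexVertex)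 (pu pv : ℕ → HexVertex), StrictMono ψ ∧ (∀ t : ℝ, dist (M.boundary t + τ) (D.boundary t) ≤ η) ∧ dist (M.pt 0 + τ) (D.pt 0) ≤ η ∧ dist (M.pt 1 + τ) (D.pt 1) ≤ η ∧ (0 < ρ' ∧ ∀ i : Fin 2, M.carrier ∩ ball (M.pt i) ρ' = {z : ℂ | (M.pt i).im < z.im} ∩ ball (M.pt i) ρ') ∧ (∀ᶠ δ' : ℝ in 𝓝[>] 0, hexDomainSimplyConnected (Λ' δ') ∧ a' δ' ∈ hexDomainBoundary (Λ' δ') ∧ b' δ' ∈ hexDomainBoundary (Λ' δ') ∧ Nonempty (HexMidEdgeSAW (Λ' δ') (a' δ') (b' δ')) ∧ (hexGraph.induce (↑(Λ' δ') : Set HexVertex)).Preconnected ∧ (∀ v ∈ Λ' δ', (δ' : ℂ) * hexCenter v ∈ M.carrier) ∧ (∀ i : Fin 2, ∀ v : HexVertex, (δ' : ℂ) * hexCenter v ∈ ball (M.pt i) ρ' → (v ∈ Λ' δ' ↔ m i δ' ≤ v.1 1))) ∧ (∀ K : Set ℂ, IsCompact K → K ⊆ M.carrier → ∀ᶠ δ'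 : ℝ in 𝓝[>] 0, ∀ v : HexVertex, (δ' : ℂ) * hexCenter v ∈ K → v ∈ Λ' δ') ∧ Tendsto (fun δ' : ℝ => (δ' : ℂ) * hexMidpoint (a' δ')) (𝓝[>] 0) (𝓝 (M.pt 0)) ∧ Tendsto (fun δ' : ℝ => (δ' : ℂ) * hexMidpoint (b' δ')) (𝓝[>] 0) (𝓝 (M.pt 1)) ∧ Tendsto (fun j : ℕ => ((δ (φ (ψ j)) : ℝ) : ℂ) * Literature.Probability.LatticeModels.triEmbed (x j)) atTop (𝓝 τ) ∧ (∀ j : ℕ, (∀ w : HexVertex, w ∈ Λ'' j ↔ ((-(x j) + w.1, w.2) : HexVertex) ∈ Λ' (δ (φ (ψ j)))) ∧ (∀ w ∈ Λ'' j, w ∉ S (φ (ψ j)) (n (φ (ψ j))) ∪ T (φ (ψ j)) (n' (φ (ψ j)))) ∧ (∀ w ∈ Λ'' j, ∀ y ∈ Λ'' j, hexGraph.Adj w y → (hexDomainGraph D.carrier (δ (φ (ψ j)))).Adj w y) ∧ q (φ (ψ j)) ∈ Λ'' j ∧ pu j ∈ S (φ (ψ j)) (n (φ (ψ j))) ∪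 T (φ (ψ j)) (n' (φ (ψ j))) ∧ pv j ∈ S (φ (ψ j)) (n (φ (ψ j))) ∪ T (φ (ψ j)) (n' (φ (ψ j))) ∧ hexGraph.Adj (q (φ (ψ j))) (pu j) ∧ s(q (φ (ψ j)), pu j) ≠ s(q' (φ (ψ j)), pv j) ∧ (a' (δ (φ (ψ j)))).map (fun w : HexVertex => ((x j + w.1, w.2) : HexVertex)) = s(q (φ (ψ j)), pu j) ∧ (b' (δ (φ (ψ j)))).map (fun w : HexVertex => ((x j + w.1, w.2) : HexVertex)) = s(q' (φ (ψ j)), pv j)) ∧ (∀ᶠ j : ℕ in atTop, 1 - ε' ≤ (carvedLaw D.carrier (δ (φ (ψ j))) (S (φ (ψ j)) (n (φ (ψ j))) ∪ T (φ (ψ j)) (n' (φ (ψ j)))) (q (φ (ψ j))) (q' (φ (ψ j))) {ξ | ∀ w ∈ ξ.walk.support, w ∈ Λ'' j}).toReal))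

/-- Sub₃ is literally item stmt-CriticalPhenomena-7148. -/
theorem hexSimpleSubseqLimits_iff_item7148 :
    HexSimpleSubseqLimits ↔ Summit.CriticalPhenomena.SAWScalingLimit.Theses.SAWLatticeVirasoro.HexSimpleSubseqLimits :=
  Iff.rfl

/-- **The glued split, certified**: the landed residue assembly IS the implication
`RenewalAbundance → SourceLocality → HexSimpleSubseqLimits → CarvedSqueeze → ObservableToSLER` (this route's decl). -/
theorem ObservableToSLER_of_subs :
    RenewalAbundance → SourceLocality → HexSimpleSubseqLimits → CarvedSqueeze → ObservableToSLER :=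
  fun h1 h2 h3 h4 =>
    Summit.CriticalPhenomena.SAWScalingLimit.Theorems.ObservableToSLER.Residue.observableToSLER_of_residueSolid h1 h2 h3 h4

#print axioms ObservableToSLER_of_subs

end Summit.CriticalPhenomena.SAWScalingLimit.Theses.SAWPhaseRetrieval
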